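import Summits.QuantumFields.BalabanUV.T4Continuum.Spine.NE3.RemainderTowerB8
import HarnessLib

/-!
# Support | NE7 (gen 96, ROAD-G96 §7, brick (Γ1)-ℓ²): NE3's ℓ² REMAINDER TOWER **WITHOUT THE FRAME CONDITION (1.37)** —
# `‖linCovIter L W (Ad_W Z) (j+1) − logCovIter L W (Ad_W Z) (j+1)‖_{ℓ²(periodBox N)} ≤ 32·C₁L²√(d(4L+1)^d)·‖Z‖_{ℓ²}·sup‖Z‖·(√(L²∕L^d)·L)^{j}`
# (the k-fold linearised double-bar average of `Z` equals the TOP NONLINEAR DOUBLE-BAR FIELD up to a k-free `sup × ℓ²` error; at d = 4 the rate is `L·M⁻¹·sup`)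

Cell `pub-balaban`, rung (B)+1 sub-cell t4, lineage `b2b-balaban-t4-ne7-p1` (CRUX PROVER NE7 #1 = OWNER of row NE7), generation 96; memo
`t4/b2b-balaban-t4-ne7-p1-g96/ROAD-G96.md` §7 (ROAD-Γ).  Twin of `NE7QbarIterL1DbarFree` for the ℓ² letter (the ν-letter side of (DL2)): this is
`Spine/NE3/RemainderTowerB8.sqrt_l2sq_QbarIter_le` (seat ne3, census R26′ step 2b-β; inputs BY NAME `RemainderSumsStepB8.sum_normSq_Ccov_le`,
`RemainderTelescopeB8.linCovIter_sub_logCovIter_eq_sum`, `RemainderTowerArith.tower_l2_induction`∕`tower_l2_total`, `RemainderTowerPrepB8.sqrt_l2sq_linCovIter_le`,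
`QbarTowerB8.linCovIter_adField`) with its ONLY use of `hdbar` — zeroing the top nonlinear field in the telescope — REMOVED: the top field is KEPT on the left-hand side
(`tower_l2_total` is abstract in the bounded quantity).  Row NE3's census item (M3) in budget-free form, ℓ² half.

WHY (memo §§1, 4, 7): see the ℓ¹ twin.  The ν-letter of the NE7 decomposition needs the ℓ² size of the part of `Qbar_top X₀` fed to the right inverse; the top double-bar field
(a top pure gauge at a pair with common plain average) is removed by a top-corner gauge adjustment instead.
WHAT ([folklore]; 0 def, 0 sorry): **`sqrt_l2sq_linCovIter_sub_logCovIter_le`** (start frame) and **`sqrt_l2sq_QbarIter_sub_le`** (end frame), same constant and hypotheses as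
the NE3 original minus `hdbar`.
HONEST FRAMING (page 1): lattice kinematics of the averaging tower on OUR frame, re-issue of a kernel theorem of row NE3; nothing of Bałaban's asserted; (DL2), `hdecomp♭`, NE7, NE3
NOT proved; spine 0∕9; finite T⁴ rung (B)+1 — NOT infinite volume, NOT mass gap, NOT `BetaPertH`, NOT Clay.  Continuum YM on T⁴ ⇐ BetaPertH ∧ nine spine estimates (0/9 proved);
BetaPertH ⇐ (D1) ∧ (D4) ∧ CAP+tail; G-an2-4 gates asym, D1 and NE2/3/4.
-/

set_option autoImplicit false
open scoped BigOperators Matrix.Norms.L2Operator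
open NormedSpace Finset

namespace Summit.QuantumFields.BalabanUV.T4Continuum.NE7QbarIterL2DbarFree

open Literature.MathematicalPhysics.QuantumFieldTheory.Balaban1983to89
open B7Prop1Explicit B7Prop2Explicit B7Prop3Flat MatrixLog
open B7Prop3GeneralLinear (Ccov linQcov Qcov)
open B7Prop4GeneralLevels (logCovIter linCovIter)
open B7Eq123General (prop4_general level_data blockLoops_of_pdev dbavgCovIter_eq_expCfg_logCovIter)
open B7Eq92Concrete (dbavgCovIter)
open B12Ineq417Flat (shiftCfg shiftCfg_apply)
open B7AvgPeriodicity (periodic_of_coord logCovIter_periodic linCovIter_periodic Qcov_periodic)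
open T4AveragingDeficitWall (IsSkewDir IsUnitaryCfg SmallField Ad dirSq)
open T4AveragingDeficitWallBoundary (IsPeriodicCfg periodBox)
open AveragingDeficitPeriodicCounting (IsPeriodicDir)
open AveragingDeficitChartCalculus (cavg)
open AveragingDeficitMultiLevelPrep (cavgIter LevelSmall radIter tower cavgIter_unitary_small isPeriodicCfg_cavgIter)
open AveragingDeficitMultiLevelBridge (cavgIter_eq_avgIter)
open AveragingDeficitTransport (norm_Ad_of_unitary)
open AveragingDeficitNearIdentity (Ad_one Ad_add Ad_neg)
open T4AveragingDeficitNonAbelian (Ad_mul)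
open NE3TangentCovariantTower (QbarIter)
open NE3CovariantLineSumsL2 (l2sq l2sq_nonneg sqrt_l2sq_add_le)
open NE3FramePotBoundW (tower_eq_pow_mul levelSmall_of_le)
open NE3FramePotBoundWClass (l2sq_QbarIter_le_class)
open NE3.QbarDictionary (adField)
open NE3.QbarTowerB8 (linCovIter_adField)
open NE3.RemainderTowerPrepB8 (shiftCfg_of_isPeriodicCfg shiftCfg_of_isPeriodicDir l2sq_adField sqrt_l2sq_neg sqrt_l2sq_finset_sum_le
  levelSmall_radIter sqrt_l2sq_linCovIter_le)
open NE3.RemainderSumsStepB8 (sum_normSq_Ccov_le)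
open NE3.RemainderTelescopeB8 (linCovIter_sub_logCovIter_eq_sum linCovIter_one)
open NE3.RemainderTowerArith (tower_l2_induction tower_l2_total)
open ShellMeasureAverageProp4General (C1cov C1cov_pos)

noncomputable section

variable {d : ℕ} {n : Type*} [Fintype n] [DecidableEq n]

/-! ## §1 The ℓ² remainder tower with the top double-bar field kept (start frame) -/

/-- **NE3's ℓ² REMAINDER TOWER WITHOUT THE FRAME CONDITION** (hypotheses of `RemainderTowerB8.sqrt_l2sq_QbarIter_le` minus `hdbar`):
`√l2sq (periodBox N) (linCovIter L W (Ad_W Z) (j+1) − logCovIter L W (Ad_W Z) (j+1)) ≤ 32·C₁L²√(d(4L+1)^d)·√l2sq Z·b·(√(L²∕L^d)·L)^{j}`. [folklore] -/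
theorem sqrt_l2sq_linCovIter_sub_logCovIter_le [Nonempty n] {L N : ℕ} (hL : 2 ≤ L) (hN : 1 ≤ N) (j : ℕ)
    {W : Site d → Fin d → (Matrix n n ℂ)ˣ} {x : ℝ} (hWu : IsUnitaryCfg W) (hWP : IsPeriodicCfg W ((N * L ^ (j + 1) : ℕ) : ℤ))
    (hx : 0 ≤ x) (hsm : LevelSmall d L j x) (hWx : SmallField W x)
    {α₀ b : ℝ} (hα : 0 < α₀) (hα3 : C0 d * (2 * α₀) ≤ 1 / 3) (hα4 : 4 * (2 * α₀) ≤ c2' d L)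
    (h52 : pdev W < α₀ * (((L : ℝ) ^ (j + 1))⁻¹) ^ 2) (hb : 0 ≤ b)
    {Z : Site d → Fin d → Matrix n n ℂ} (hZ : ∀ (y : Site d) (κ : Fin d), ‖Z y κ‖ ≤ b) (hZP : IsPeriodicDir Z ((N * L ^ (j + 1) : ℕ) : ℤ))
    (hsmall : Real.exp (4 * (800 * ((d : ℝ) + 1) ^ 2 * ((d : ℝ) + 4)) * α₀)
      * (1 + 8 * (131072 * ((d : ℝ) + 1) ^ 2) * ((L : ℝ) ^ (j + 1) * b)) ≤ 2)
    (hc₃ : 4 * ((L : ℝ) ^ (j + 1) * b) ≤ c3 d L)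
    (hK : 16 * (C1cov d * (L : ℝ) ^ 2 * Real.sqrt (d * (2 * (2 * L) + 1) ^ d)) * (L : ℝ) ^ (j + 1) * b ≤ Real.sqrt ((L : ℝ) ^ 2 / (L : ℝ) ^ d)) :
    Real.sqrt (l2sq (periodBox (d := d) N) (linCovIter L W (adField W Z) (j + 1) - logCovIter L W (adField W Z) (j + 1)))
      ≤ 32 * (C1cov d * (L : ℝ) ^ 2 * Real.sqrt (d * (2 * (2 * L) + 1) ^ d))
          * Real.sqrt (l2sq (periodBox (d := d) (N * L ^ (j + 1))) Z) * b * (Real.sqrt ((L : ℝ) ^ 2 / (L : ℝ) ^ d) * L) ^ (j + 1 - 1) := by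
  letI : CStarAlgebra (Matrix n n ℂ) := {}
  have hL1 : 1 ≤ L := by omega
  have hL0 : (0 : ℝ) < L := by exact_mod_cast (show 0 < L by omega)
  have hLR : (2 : ℝ) ≤ L := by exact_mod_cast hL
  set k : ℕ := j + 1 with hk
  set K : ℝ := C1cov d * (L : ℝ) ^ 2 * Real.sqrt (d * (2 * (2 * L) + 1) ^ d) with hKdef
  set ρ : ℝ := Real.sqrt ((L : ℝ) ^ 2 / (L : ℝ) ^ d) with hρdef
  have hK0 : 0 ≤ K := by rw [hKdef]; have := C1cov_pos d; positivity
  have hρ0 : 0 < ρ := by rw [hρdef]; positivity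
  -- the fine field `B = Ad_W Z` and the regime data
  set B : Site d → Fin d → Matrix n n ℂ := adField W Z with hBdef
  have hBsup : ∀ (y : Site d) (κ : Fin d), ‖B y κ‖ ≤ b := fun y κ => by
    rw [hBdef]; unfold adField; rw [norm_Ad_of_unitary (hWu y κ)]; exact hZ y κ
  have hG := avgClosed_unitaryUnits d (𝔸 := Matrix n n ℂ) L
  have hU₀ : ∀ (y : Site d) (κ : Fin d), W y κ ∈ unitaryUnits (Matrix n n ℂ) := hWu
  have hα3' : C0 d * α₀ ≤ 1 / 3 := by
    have hC : 0 ≤ C0 d := by unfold C0; positivity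
    nlinarith
  have hα4' : 4 * α₀ ≤ c2' d L := by linarith
  have hc₃' : 2 * ((L : ℝ) ^ k * b) ≤ c3 d L := by rw [hk]; nlinarith [pow_pos hL0 (j + 1)]
  have h4 := prop4_general L hL hG k W hU₀ hα hα3' hα4' h52 B hb hBsup hsmall hc₃'
  have hld := level_data L hL hG k W hU₀ hα hα3' hα4' h52
  -- loops of every averaged background below the top
  have hloopsW : ∀ i < k, ∀ (z : Site d) (κ : Fin d) (r : Fin d → Fin L),
      ‖((Wcx L (cavgIter L i W) ((L : ℤ) • z) κ (boxVec L r) : (Matrix n n ℂ)ˣ) : Matrix n n ℂ) - 1‖ < 1 := by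
    intro i hi z κ r
    obtain ⟨hV, hβ0, hβ, hβmax⟩ := hld i hi.le
    rw [cavgIter_eq_avgIter]
    have h := blockLoops_of_pdev hL1 hV hβ0 hβ hβmax ((L : ℤ) • z) κ
    exact ((h.1 r).trans h.2).trans_lt (by norm_num)
  -- periodicity bookkeeping: `L^i · (N·L^{k−i}) = N·L^k`
  have hPk : ∀ i ≤ k, L ^ i * (N * L ^ (k - i)) = N * L ^ k := by
    intro i hi
    rw [mul_left_comm, ← pow_add, Nat.add_sub_cancel' hi]
  have hWsh : ∀ a : Site d, shiftCfg (((N * L ^ k : ℕ) : ℤ) • a) W = W := shiftCfg_of_isPeriodicCfg hWP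
  have hBP : IsPeriodicDir B ((N * L ^ k : ℕ) : ℤ) := by
    intro y i μ; rw [hBdef]; unfold adField; rw [hWP y i μ, hZP y i μ]
  have hBsh : ∀ a : Site d, shiftCfg (((N * L ^ k : ℕ) : ℤ) • a) B = B := shiftCfg_of_isPeriodicDir hBP
  -- the nonlinear iterates: sup (Prop. 4) and periodicity
  have hAsup : ∀ i ≤ k, ∀ (y : Site d) (κ : Fin d), ‖logCovIter L W B i y κ‖ ≤ 2 * ((L : ℝ) ^ i * b) :=
    fun i hi => (h4 i hi).2
  have hAP : ∀ i ≤ k, ∀ (y : Site d) (κ μ : Fin d),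
      logCovIter L W B i (y + ((N * L ^ (k - i) : ℕ) : ℤ) • e κ) μ = logCovIter L W B i y μ := by
    intro i hi y κ μ
    have hT : ∀ a : Site d, shiftCfg ((((L : ℤ) ^ i) * ((N * L ^ (k - i) : ℕ) : ℤ)) • a) W = W := by
      intro a
      have e : ((L : ℤ) ^ i) * ((N * L ^ (k - i) : ℕ) : ℤ) = ((N * L ^ k : ℕ) : ℤ) := by
        rw [← hPk i hi]; push_cast; ring
      rw [e]; exact hWsh a
    have hT' : ∀ a : Site d, shiftCfg ((((L : ℤ) ^ i) * ((N * L ^ (k - i) : ℕ) : ℤ)) • a) B = B := by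
      intro a
      have e : ((L : ℤ) ^ i) * ((N * L ^ (k - i) : ℕ) : ℤ) = ((N * L ^ k : ℕ) : ℤ) := by
        rw [← hPk i hi]; push_cast; ring
      rw [e]; exact hBsh a
    exact logCovIter_periodic L W B i hT hT' (e κ) y μ
  -- per-level averaged backgrounds: pointwise periodicity
  have hVP : ∀ i ≤ k, IsPeriodicCfg (cavgIter L i W) ((N * L ^ (k - i) : ℕ) : ℤ) := by
    intro i hi
    refine isPeriodicCfg_cavgIter L (N * L ^ (k - i)) i ?_
    rw [tower_eq_pow_mul, hPk i hi]; exact hWP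
  -- the sequences of the tower
  set Cf : ℕ → Site d → Fin d → Matrix n n ℂ :=
    fun i z κ => Ccov L (avgIter L W i) (logCovIter L W B i) ((L : ℤ) • z) κ with hCf
  set a : ℕ → ℝ := fun i => Real.sqrt (l2sq (periodBox (d := d) (N * L ^ (k - i))) (logCovIter L W B i)) with hadef
  set c : ℕ → ℝ := fun i => if i < k then Real.sqrt (l2sq (periodBox (d := d) (N * L ^ (k - (i + 1)))) (Cf i)) else 0 with hcdef
  set β : ℝ := Real.sqrt (l2sq (periodBox (d := d) (N * L ^ k)) B) with hβdef
  have hβ0 : 0 ≤ β := Real.sqrt_nonneg _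
  -- periodicity of the one-step remainder fields: `Cf i` is `(N·L^{k−(i+1)})`-periodic for `i < k`
  have hCfP : ∀ i < k, IsPeriodicDir (Cf i) ((N * L ^ (k - (i + 1)) : ℕ) : ℤ) := by
    intro i hi z κ' μ
    have hP1 : L ^ 1 * (N * L ^ (k - (i + 1))) = N * L ^ (k - i) := by
      rw [pow_one, mul_left_comm, ← pow_succ']; congr 2; omega
    have hVsh : ∀ a : Site d, shiftCfg ((((L : ℤ) ^ 1) * ((N * L ^ (k - (i + 1)) : ℕ) : ℤ)) • a) (avgIter L W i) = avgIter L W i := by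
      intro a
      have e : ((L : ℤ) ^ 1) * ((N * L ^ (k - (i + 1)) : ℕ) : ℤ) = ((N * L ^ (k - i) : ℕ) : ℤ) := by
        rw [← hP1]; push_cast; ring
      rw [e, ← cavgIter_eq_avgIter]; exact shiftCfg_of_isPeriodicCfg (hVP i hi.le) a
    have hAsh : ∀ a : Site d, shiftCfg ((((L : ℤ) ^ 1) * ((N * L ^ (k - (i + 1)) : ℕ) : ℤ)) • a) (logCovIter L W B i) = logCovIter L W B i := by
      intro a
      have e : ((L : ℤ) ^ 1) * ((N * L ^ (k - (i + 1)) : ℕ) : ℤ) = ((N * L ^ (k - i) : ℕ) : ℤ) := by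
        rw [← hP1]; push_cast; ring
      rw [e]; exact shiftCfg_of_isPeriodicDir (fun y κ μ => hAP i hi.le y κ μ) a
    -- the remainder is `Q − L(Q·)`; both are periodic
    have hQ : Qcov L (avgIter L W i) (logCovIter L W B i) ((L : ℤ) • (z + ((N * L ^ (k - (i + 1)) : ℕ) : ℤ) • e κ')) μ
        = Qcov L (avgIter L W i) (logCovIter L W B i) ((L : ℤ) • z) μ := by
      have e1 : (L : ℤ) • (z + ((N * L ^ (k - (i + 1)) : ℕ) : ℤ) • e κ') = (L : ℤ) • z + (((N * L ^ (k - i) : ℕ) : ℤ)) • e κ' := by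
        rw [smul_add, smul_smul, ← hP1]; push_cast; ring_nf
      rw [e1]
      refine Qcov_periodic L _ _ ?_ ?_ _ μ
      · rw [← cavgIter_eq_avgIter]
        have := shiftCfg_of_isPeriodicCfg (hVP i hi.le) (e κ')
        exact this
      · exact shiftCfg_of_isPeriodicDir (fun y κ μ => hAP i hi.le y κ μ) (e κ')
    have hLin : linQcov L (avgIter L W i) (logCovIter L W B i) ((L : ℤ) • (z + ((N * L ^ (k - (i + 1)) : ℕ) : ℤ) • e κ')) μ
        = linQcov L (avgIter L W i) (logCovIter L W B i) ((L : ℤ) • z) μ := by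
      rw [← linCovIter_one, ← linCovIter_one]
      exact linCovIter_periodic L (avgIter L W i) (logCovIter L W B i) 1 hVsh hAsh (e κ') z μ
    simp only [hCf, Ccov, hQ, hLin]
  -- BOUND 1: the linear propagation of `B` itself
  have hB1 : ∀ i ≤ k, Real.sqrt (l2sq (periodBox (d := d) (N * L ^ (k - i))) (linCovIter L W B i)) ≤ 2 * ρ ^ i * β := by
    intro i hi
    have hP : 1 ≤ N * L ^ (k - i) := Nat.one_le_iff_ne_zero.mpr (Nat.mul_ne_zero (by omega) (pow_ne_zero _ (by omega)))
    have hWP' : IsPeriodicCfg W ((L ^ i * (N * L ^ (k - i)) : ℕ) : ℤ) := by rw [hPk i hi]; exact hWP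
    have hBP' : IsPeriodicDir B ((L ^ i * (N * L ^ (k - i)) : ℕ) : ℤ) := by rw [hPk i hi]; exact hBP
    have h := sqrt_l2sq_linCovIter_le hL hP (j' := j) i (by omega) hWu hWP' hx hsm hWx
      (fun i'' hi'' => hloopsW i'' (by omega)) hBP'
    rw [hPk i hi] at h
    exact h
  -- BOUND 2: the linear propagation of the level-`i′` remainder from the background `Ū₀^{i′+1}`
  have hB2 : ∀ i ≤ k, ∀ i' < i, Real.sqrt (l2sq (periodBox (d := d) (N * L ^ (k - i)))
        (linCovIter L (avgIter L W (i' + 1)) (Cf i') (i - (i' + 1)))) ≤ 2 * ρ ^ (i - 1 - i') * c i' := by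
    intro i hi i' hi'
    have hik : i' < k := by omega
    have hci : c i' = Real.sqrt (l2sq (periodBox (d := d) (N * L ^ (k - (i' + 1)))) (Cf i')) := by
      simp only [hcdef, if_pos hik]
    set m : ℕ := i - (i' + 1) with hm
    have hm' : i - 1 - i' = m := by omega
    rw [hm', hci]
    have hP : 1 ≤ N * L ^ (k - i) := Nat.one_le_iff_ne_zero.mpr (Nat.mul_ne_zero (by omega) (pow_ne_zero _ (by omega)))
    have hsrc : L ^ m * (N * L ^ (k - i)) = N * L ^ (k - (i' + 1)) := by
      rw [mul_left_comm, ← pow_add]; congr 2; omega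
    rcases Nat.eq_zero_or_pos m with hm0 | hmpos
    · -- no propagation: the trivial bound `√l2sq ≤ 2·√l2sq`
      rw [hm0, pow_zero, mul_one]
      have e0 : k - i = k - (i' + 1) := by omega
      rw [show linCovIter L (avgIter L W (i' + 1)) (Cf i') 0 = Cf i' from rfl, e0]
      have := Real.sqrt_nonneg (l2sq (periodBox (d := d) (N * L ^ (k - (i' + 1)))) (Cf i'))
      linarith
    · -- genuine propagation: class data at `Ū₀^{i′+1} = cavgIter (i′+1) W`
      have hi'j : i' + 1 ≤ j := by omega
      obtain ⟨hW'u, hr0, hW'x⟩ := cavgIter_unitary_small hL1 i' hWu hx (levelSmall_of_le (by omega) hsm) hWx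
      have hsm' : LevelSmall d L (j - (i' + 1)) (radIter d L (i' + 1) x) := by
        refine levelSmall_radIter (i' + 1) (j - (i' + 1)) ?_
        rw [Nat.add_sub_cancel' hi'j]; exact hsm
      have hW'P : IsPeriodicCfg (cavgIter L (i' + 1) W) ((L ^ m * (N * L ^ (k - i)) : ℕ) : ℤ) := by
        rw [hsrc]; exact hVP (i' + 1) hik
      have hCfP' : IsPeriodicDir (Cf i') ((L ^ m * (N * L ^ (k - i)) : ℕ) : ℤ) := by rw [hsrc]; exact hCfP i' hik
      have hloops' : ∀ i'' < m, ∀ (z : Site d) (κ : Fin d) (r : Fin d → Fin L),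
          ‖((Wcx L (cavgIter L i'' (cavgIter L (i' + 1) W)) ((L : ℤ) • z) κ (boxVec L r) : (Matrix n n ℂ)ˣ) : Matrix n n ℂ) - 1‖ < 1 := by
        intro i'' hi'' z κ r
        have e : cavgIter L i'' (cavgIter L (i' + 1) W) = cavgIter L (i' + 1 + i'') W := by
          rw [cavgIter_eq_avgIter, cavgIter_eq_avgIter, cavgIter_eq_avgIter, ← B9Eq315QTower.avgIter_add]
        rw [e]; exact hloopsW (i' + 1 + i'') (by omega) z κ r
      have h := sqrt_l2sq_linCovIter_le hL hP (j' := j - (i' + 1)) m (by omega) hW'u hW'P hr0 hsm' hW'x hloops' hCfP'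
      rw [cavgIter_eq_avgIter, hsrc] at h
      exact h
  -- (hc): the one-step remainder in ℓ² (step 1) at every level `i < k`
  have hcK : ∀ i ≤ k, c i ≤ K * (2 * (L : ℝ) ^ i * b) * a i := by
    intro i hi
    by_cases hik : i < k
    · have hci : c i = Real.sqrt (l2sq (periodBox (d := d) (N * L ^ (k - (i + 1)))) (Cf i)) := by
        simp only [hcdef, if_pos hik]
      obtain ⟨hV, hβ0', hβ', hβmax'⟩ := hld i hi
      have hN₁ : 1 ≤ N * L ^ (k - (i + 1)) := Nat.one_le_iff_ne_zero.mpr (Nat.mul_ne_zero (by omega) (pow_ne_zero _ (by omega)))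
      have hLN : L * (N * L ^ (k - (i + 1))) = N * L ^ (k - i) := by
        rw [mul_left_comm, ← pow_succ']; congr 2; omega
      have hLi : (L : ℝ) ^ i ≤ (L : ℝ) ^ k := pow_le_pow_right₀ (by linarith) hi
      have ha0 : 0 ≤ 2 * ((L : ℝ) ^ i * b) := by positivity
      have hac : 2 * ((L : ℝ) ^ i * b) ≤ c3 d L / 2 := by nlinarith [mul_le_mul_of_nonneg_right hLi hb]
      have hAP' : ∀ (y : Site d) (κ μ : Fin d),
          logCovIter L W B i (y + ((L * (N * L ^ (k - (i + 1))) : ℕ) : ℤ) • e κ) μ = logCovIter L W B i y μ := by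
        rw [hLN]; exact hAP i hi
      have hstep := sum_normSq_Ccov_le hL1 hV hβ0' hβ' hβmax' hN₁ (logCovIter L W B i) ha0 (hAsup i hi) hac hAP'
      rw [hLN] at hstep
      -- `hstep : l2sq (Cf i) ≤ (C₁L²)²·a²·(d(4L+1)^d)·l2sq (A_i)`
      have hl : l2sq (periodBox (d := d) (N * L ^ (k - (i + 1)))) (Cf i)
          ≤ (K * (2 * ((L : ℝ) ^ i * b))) ^ 2 * l2sq (periodBox (d := d) (N * L ^ (k - i))) (logCovIter L W B i) := by
        have e : (K * (2 * ((L : ℝ) ^ i * b))) ^ 2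
            = (C1cov d * (L : ℝ) ^ 2) ^ 2 * (2 * ((L : ℝ) ^ i * b)) ^ 2 * (d * (2 * (2 * (L : ℝ)) + 1) ^ d) := by
          rw [hKdef, mul_pow, mul_pow, Real.sq_sqrt (by positivity)]; ring
        rw [e]
        exact hstep
      rw [hci, hadef]
      calc Real.sqrt (l2sq (periodBox (d := d) (N * L ^ (k - (i + 1)))) (Cf i))
          ≤ Real.sqrt ((K * (2 * ((L : ℝ) ^ i * b))) ^ 2 * l2sq (periodBox (d := d) (N * L ^ (k - i))) (logCovIter L W B i)) :=
            Real.sqrt_le_sqrt hl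
        _ = K * (2 * (L : ℝ) ^ i * b) * Real.sqrt (l2sq (periodBox (d := d) (N * L ^ (k - i))) (logCovIter L W B i)) := by
            rw [Real.sqrt_mul (sq_nonneg _), Real.sqrt_sq (mul_nonneg hK0 ha0)]; ring
    · have hci : c i = 0 := by simp only [hcdef, if_neg hik]
      rw [hci]
      have ha0' : 0 ≤ a i := by rw [hadef]; exact Real.sqrt_nonneg _
      have hL2 : 0 ≤ 2 * (L : ℝ) ^ i * b := by positivity
      exact mul_nonneg (mul_nonneg hK0 hL2) ha0'
  -- (ha): the telescoped identity at level `i`, in ℓ²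
  have haK : ∀ i ≤ k, a i ≤ 2 * ρ ^ i * β + ∑ i' ∈ Finset.range i, 2 * ρ ^ (i - 1 - i') * c i' := by
    intro i hi
    have hLi : (L : ℝ) ^ i ≤ (L : ℝ) ^ k := pow_le_pow_right₀ (by linarith) hi
    have h52i : pdev W < α₀ * (((L : ℝ) ^ i)⁻¹) ^ 2 := by
      refine h52.trans_le (mul_le_mul_of_nonneg_left ?_ hα.le)
      have h1 : ((L : ℝ) ^ k)⁻¹ ≤ ((L : ℝ) ^ i)⁻¹ := inv_anti₀ (by positivity) hLi
      exact pow_le_pow_left₀ (by positivity) h1 2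
    have hid := linCovIter_sub_logCovIter_eq_sum L hL hG i W hU₀ hα hα3 hα4 h52i B
    set S : Site d → Fin d → Matrix n n ℂ := ∑ i' ∈ Finset.range i, linCovIter L (avgIter L W (i' + 1)) (Cf i') (i - (i' + 1)) with hS
    have hAeq : logCovIter L W B i = linCovIter L W B i + S := by
      have h := hid
      rw [sub_eq_iff_eq_add] at h
      rw [h]; abel
    have h1 := sqrt_l2sq_add_le (periodBox (d := d) (N * L ^ (k - i))) (linCovIter L W B i) S
    have h2 := sqrt_l2sq_finset_sum_le (Finset.range i) (periodBox (d := d) (N * L ^ (k - i)))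
      (fun i' => linCovIter L (avgIter L W (i' + 1)) (Cf i') (i - (i' + 1)))
    have h3 : ∑ i' ∈ Finset.range i, Real.sqrt (l2sq (periodBox (d := d) (N * L ^ (k - i)))
        (linCovIter L (avgIter L W (i' + 1)) (Cf i') (i - (i' + 1)))) ≤ ∑ i' ∈ Finset.range i, 2 * ρ ^ (i - 1 - i') * c i' :=
      Finset.sum_le_sum fun i' hi' => hB2 i hi i' (Finset.mem_range.mp hi')
    rw [hadef]
    show Real.sqrt (l2sq (periodBox (d := d) (N * L ^ (k - i))) (logCovIter L W B i)) ≤ _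
    rw [hAeq]
    exact h1.trans (add_le_add (hB1 i hi) (h2.trans h3))
  -- (hE): the full remainder, with the top nonlinear field KEPT (no (1.37))
  have hEle : Real.sqrt (l2sq (periodBox (d := d) N) (linCovIter L W B k - logCovIter L W B k))
      ≤ ∑ i ∈ Finset.range k, 2 * ρ ^ (k - 1 - i) * c i := by
    have hlin : linCovIter L W B k - logCovIter L W B k
        = -∑ i ∈ Finset.range k, linCovIter L (avgIter L W (i + 1)) (Cf i) (k - (i + 1)) :=
      linCovIter_sub_logCovIter_eq_sum L hL hG k W hU₀ hα hα3 hα4 h52 B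
    have hNk : N * L ^ (k - k) = N := by rw [Nat.sub_self, pow_zero, mul_one]
    have h2 := sqrt_l2sq_finset_sum_le (Finset.range k) (periodBox (d := d) (N * L ^ (k - k)))
      (fun i' => linCovIter L (avgIter L W (i' + 1)) (Cf i') (k - (i' + 1)))
    have h3 : ∑ i' ∈ Finset.range k, Real.sqrt (l2sq (periodBox (d := d) (N * L ^ (k - k)))
        (linCovIter L (avgIter L W (i' + 1)) (Cf i') (k - (i' + 1)))) ≤ ∑ i' ∈ Finset.range k, 2 * ρ ^ (k - 1 - i') * c i' :=
      Finset.sum_le_sum fun i' hi' => hB2 k le_rfl i' (Finset.mem_range.mp hi')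
    rw [hNk] at h2 h3
    rw [hlin, sqrt_l2sq_neg]
    exact h2.trans h3
  -- the tower bookkeeping
  have hKline : 16 * K * (L : ℝ) ^ k * b ≤ ρ := hK
  have htot := tower_l2_total (k := k) (a := a) (c := c) hρ0 hLR hb hβ0 hK0 hKline haK hcK hEle
  -- the size of `Z` in the start frame equals that of `B`
  have hβZ : β = Real.sqrt (l2sq (periodBox (d := d) (N * L ^ k)) Z) := by rw [hβdef, hBdef, l2sq_adField hWu]
  rw [← hβZ]
  calc Real.sqrt (l2sq (periodBox (d := d) N) (linCovIter L W B k - logCovIter L W B k)) ≤ 32 * K * β * b * (ρ * L) ^ (k - 1) := htot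
    _ = 32 * K * β * b * (ρ * L) ^ (j + 1 - 1) := by rw [hk]



/-! ## §2 The same in the END frame of the tower -/

/-- **END-FRAMED FORM**: with `Ū := cavgIter L (j+1) W`, `√l2sq (periodBox N) (z κ ↦ QbarIter L (j+1) W Z z κ − Ad (Ū z κ)⁻¹ (logCovIter L W (Ad_W Z) (j+1) z κ))` obeys the
same bound (`QbarTowerB8.linCovIter_adField`, `l2sq` is `Ad`-invariant).  With `hdbar` the subtracted field is `0` and this is the NE3 original. [folklore] -/
theorem sqrt_l2sq_QbarIter_sub_le [Nonempty n] {L N : ℕ} (hL : 2 ≤ L) (hN : 1 ≤ N) (j : ℕ)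
    {W : Site d → Fin d → (Matrix n n ℂ)ˣ} {x : ℝ} (hWu : IsUnitaryCfg W) (hWP : IsPeriodicCfg W ((N * L ^ (j + 1) : ℕ) : ℤ))
    (hx : 0 ≤ x) (hsm : LevelSmall d L j x) (hWx : SmallField W x)
    {α₀ b : ℝ} (hα : 0 < α₀) (hα3 : C0 d * (2 * α₀) ≤ 1 / 3) (hα4 : 4 * (2 * α₀) ≤ c2' d L)
    (h52 : pdev W < α₀ * (((L : ℝ) ^ (j + 1))⁻¹) ^ 2) (hb : 0 ≤ b)
    {Z : Site d → Fin d → Matrix n n ℂ} (hZ : ∀ (y : Site d) (κ : Fin d), ‖Z y κ‖ ≤ b) (hZP : IsPeriodicDir Z ((N * L ^ (j + 1) : ℕ) : ℤ))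
    (hsmall : Real.exp (4 * (800 * ((d : ℝ) + 1) ^ 2 * ((d : ℝ) + 4)) * α₀)
      * (1 + 8 * (131072 * ((d : ℝ) + 1) ^ 2) * ((L : ℝ) ^ (j + 1) * b)) ≤ 2)
    (hc₃ : 4 * ((L : ℝ) ^ (j + 1) * b) ≤ c3 d L)
    (hK : 16 * (C1cov d * (L : ℝ) ^ 2 * Real.sqrt (d * (2 * (2 * L) + 1) ^ d)) * (L : ℝ) ^ (j + 1) * b ≤ Real.sqrt ((L : ℝ) ^ 2 / (L : ℝ) ^ d)) :
    Real.sqrt (l2sq (periodBox (d := d) N) (fun z κ => QbarIter L (j + 1) W Z z κ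
        - Ad ((cavgIter L (j + 1) W) z κ)⁻¹ (logCovIter L W (adField W Z) (j + 1) z κ)))
      ≤ 32 * (C1cov d * (L : ℝ) ^ 2 * Real.sqrt (d * (2 * (2 * L) + 1) ^ d))
          * Real.sqrt (l2sq (periodBox (d := d) (N * L ^ (j + 1))) Z) * b * (Real.sqrt ((L : ℝ) ^ 2 / (L : ℝ) ^ d) * L) ^ (j + 1 - 1) := by
  letI : CStarAlgebra (Matrix n n ℂ) := {}
  have hL1 : 1 ≤ L := by omega
  have h := sqrt_l2sq_linCovIter_sub_logCovIter_le hL hN j hWu hWP hx hsm hWx hα hα3 hα4 h52 hb hZ hZP hsmall hc₃ hK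
  have hG := avgClosed_unitaryUnits d (𝔸 := Matrix n n ℂ) L
  have hU₀ : ∀ (y : Site d) (κ : Fin d), W y κ ∈ unitaryUnits (Matrix n n ℂ) := hWu
  have hα3' : C0 d * α₀ ≤ 1 / 3 := by
    have hC : 0 ≤ C0 d := by unfold C0; positivity
    nlinarith
  have hα4' : 4 * α₀ ≤ c2' d L := by linarith
  have hld := level_data L hL hG (j + 1) W hU₀ hα hα3' hα4' h52
  have hloopsW : ∀ i < j + 1, ∀ (z : Site d) (κ : Fin d) (r : Fin d → Fin L),
      ‖((Wcx L (cavgIter L i W) ((L : ℤ) • z) κ (boxVec L r) : (Matrix n n ℂ)ˣ) : Matrix n n ℂ) - 1‖ < 1 := by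
    intro i hi z κ r
    obtain ⟨hV, hβ0, hβ, hβmax⟩ := hld i hi.le
    rw [cavgIter_eq_avgIter]
    have h' := blockLoops_of_pdev hL1 hV hβ0 hβ hβmax ((L : ℤ) • z) κ
    exact ((h'.1 r).trans h'.2).trans_lt (by norm_num)
  have hVk : IsUnitaryCfg (cavgIter L (j + 1) W) := (cavgIter_unitary_small hL1 j hWu hx hsm hWx).1
  have hdict : linCovIter L W (adField W Z) (j + 1) = adField (cavgIter L (j + 1) W) (QbarIter L (j + 1) W Z) :=
    linCovIter_adField L W Z (j + 1) hloopsW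
  have hconj : adField (cavgIter L (j + 1) W) (fun z κ => QbarIter L (j + 1) W Z z κ
        - Ad ((cavgIter L (j + 1) W) z κ)⁻¹ (logCovIter L W (adField W Z) (j + 1) z κ))
      = linCovIter L W (adField W Z) (j + 1) - logCovIter L W (adField W Z) (j + 1) := by
    rw [hdict]
    funext z κ
    show Ad ((cavgIter L (j + 1) W) z κ) (QbarIter L (j + 1) W Z z κ
          - Ad ((cavgIter L (j + 1) W) z κ)⁻¹ (logCovIter L W (adField W Z) (j + 1) z κ))
        = Ad ((cavgIter L (j + 1) W) z κ) (QbarIter L (j + 1) W Z z κ) - logCovIter L W (adField W Z) (j + 1) z κ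
    rw [sub_eq_add_neg, Ad_add, Ad_neg, ← Ad_mul, mul_inv_cancel, Ad_one, ← sub_eq_add_neg]
  rw [← l2sq_adField hVk, hconj]
  exact h

end

end Summit.QuantumFields.BalabanUV.T4Continuum.NE7QbarIterL2DbarFree
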